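import Summits.AnomalousDissipation.AnomalousDissipation.Theorems.ResolvedDissipation.Negative.ShearMode
import Summits.AnomalousDissipation.AnomalousDissipation.Theorems.CubicParityLoud.Negative.EnergyRow

/-!
# Negative knowledge for the crux `MomentParity.ResolvedDissipation` (stmt-AnomalousDissipation-14284):
# III — levelwise triviality, kill shape, the `N`-uniform budget, schedule calculus

Certified copy of §3, §5, §6, §7 of the cdisprove work file `Cruxes/ResolvedDissipation/Disproof.lean`
(refuter-cdisprove-stmt-AnomalousDissipation-14284-0, cycle 1). Supports stmt-AnomalousDissipation-14284; no
positive route-item statement is asserted (all auxiliary statements inline, no named facts).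

* `resolvedDissipationLevelwise_holds` — with `∀ N ∃ κ` the statement is TRIVIAL (`κ ≡ N`, exact, by
  `eGradNormSq_fourierTruncate_of_isLevel`): the content of the crux is the uniformity of one schedule in `N`.
* `not_resolvedDissipation_iff_killShape` — `¬` crux ⟺ a fixed `(f, ν, R, n)` and for every cutoff `K` an
  unresolved invariant law (pure logic), necessarily at level `N > K` (`isResolved_const_of_level_le`).
* `ensembleEnstrophy_le_of_isStationary` — the `N`-uniform budget `∫⁻ ‖∇u‖² dμ ≤ ‖f‖₂R/ν` (energy row of
  `CubicParityLoud/Negative/EnergyRow` + Cauchy–Schwarz): only the spectral DISTRIBUTION is at stake.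
* `IsResolved.mono`, `IsResolved.of_le` — resolution is monotone in the cutoff and in the tolerance (WLOG `κ`
  monotone and above any prescribed level).
-/

noncomputable section

-- `Summit.<Summit>.<Problem>` is the tree's mandated summit-side namespace (CONVENTIONS §2); for this
-- single-conjunct summit the two segments coincide, so the duplicate is deliberate.
set_option linter.dupNamespace false

namespace Summit.AnomalousDissipation.AnomalousDissipation.Theorems.ResolvedDissipation.Negative

open MeasureTheory Filter Topology
open scoped ENNReal InnerProductSpace RealInnerProductSpace
open Literature.Analysis.FunctionSpaces Literature.Analysis.FluidPDE
open Summit.AnomalousDissipation.AnomalousDissipation.Theses.MomentParity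
open Summit.AnomalousDissipation.AnomalousDissipation.Theorems.QuarticGate.Negative

/-- Local notation for the real Hilbert space `L²(T³; ℝ³)`. -/
local notation "L2T3" => Lp (EuclideanSpace ℝ (Fin 3)) 2 (volume : Measure (UnitAddTorus (Fin 3)))

/-! ## §3 The quantifier order is the whole content: `∀ N ∃ κ` is free (`κ ≡ N`) -/

section Levelwise

/-- On a level-`N` field the truncation `P_N` loses no enstrophy: `‖∇P_N u‖² = ‖∇u‖²`
(`𝓕(P_N u) = û` on the ball, and `û = 0` off it). [folklore] -/
theorem eGradNormSq_fourierTruncate_of_isLevel {N : ℕ} {u : H3} (hu : IsLevel N u) :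
    Torus.eGradNormSq (Torus.fourierTruncate N ((u.1 : L2T3) : T3 → R3)) =
      Torus.eGradNormSq ((u.1 : L2T3) : T3 → R3) := by
  have hint : Integrable ((u.1 : L2T3) : T3 → R3) volume := (Lp.memLp (u.1 : L2T3)).integrable one_le_two
  rw [Torus.eGradNormSq_eq_tsum, Torus.eGradNormSq_eq_tsum]
  congr 1
  refine tsum_congr fun k => ?_
  rw [Torus.mFourierCoeff_fourierTruncate hint N k]
  by_cases hk : k ∈ Torus.freqBall N
  · rw [if_pos hk]
  · rw [if_neg hk, hu k fun h => hk (Finset.mem_of_mem_erase h)]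

/-- **The levelwise statement is trivial** (`κ ≡ N`, exact resolution, no stationarity / support / viscosity
used): all the content of the crux is the UNIFORMITY of one schedule over all levels `N → ∞`.
(The statement proved — WEAKENING 4 (quantifier swap) — `ResolvedDissipation` with `∃ κ ∀ N` weakened to `∀ N ∃ κ`.) [folklore] -/
theorem resolvedDissipationLevelwise_holds :
    ∀ f : T3 → R3, Torus.IsSmooth f → Torus.IsDivFree f → Torus.HasZeroMean f →
        ∀ ν : ℝ, 0 < ν → ∀ R : ℝ, ∀ N : ℕ, ∃ κ : ℕ → ℕ, ∀ μ : Measure H3, IsProbabilityMeasure μ →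
          (∀ᵐ u ∂μ, IsLevel N u) → (∀ᵐ u ∂μ, ‖u‖ ≤ R) → IsStationary ν f N μ → ∀ n, IsResolved κ μ n := by
  intro f _ _ _ ν _ R N
  refine ⟨fun _ => N, fun μ _ hlev _ _ n => ?_⟩
  unfold IsResolved
  rw [lintegral_congr_ae (hlev.mono fun u hu => (eGradNormSq_fourierTruncate_of_isLevel hu).symm)]
  exact le_self_add

end Levelwise


/-! ## §5 Kill shape: what a disproof must exhibit (pure logic)

`¬ResolvedDissipation` ⟺ ONE force/viscosity/radius and ONE tolerance `1/(n+1)` such that for EVERY cutoff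
`K` some invariant level-`N` law in the ball keeps mean enstrophy `> 1/(n+1)` above `K` — necessarily at levels
`N > K` escaping to infinity (at `N ≤ K` the truncation is exact, §3). This is the "enstrophy leakage at
fixed `ν`" of the findings: its weak-* limit points are stationary statistical solutions with STRICT mean
energy inequality. -/

section KillShape

/-- **Kill shape** (`∀ κ ∃ (N, μ, n)` ⟺ `∃ n ∀ K ∃ (N, μ)`, by choice): a disproof of the crux is exactly a
fixed-`ν` family of invariant Galerkin laws in a common ball leaking a fixed amount of enstrophy past every
cutoff.
(The right-hand side is the KILL SHAPE — The shape of a kill: a fixed `(f, ν, R, n)` and, for every cutoff `K`, an unresolved invariant law.) [folklore] -/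
theorem not_resolvedDissipation_iff_killShape :
    ¬ ResolvedDissipation ↔
      ∃ f : T3 → R3, Torus.IsSmooth f ∧ Torus.IsDivFree f ∧ Torus.HasZeroMean f ∧
          ∃ ν : ℝ, 0 < ν ∧ ∃ (R : ℝ) (n : ℕ), ∀ K : ℕ, ∃ (N : ℕ) (μ : Measure H3), IsProbabilityMeasure μ ∧
            (∀ᵐ u ∂μ, IsLevel N u) ∧ (∀ᵐ u ∂μ, ‖u‖ ≤ R) ∧ IsStationary ν f N μ ∧ ¬ IsResolved (fun _ => K) μ n := by
  rw [resolvedDissipation_iff]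
  constructor
  · intro h
    push Not at h
    obtain ⟨f, hf, hd, hz, ν, hν, R, hR⟩ := h
    refine ⟨f, hf, hd, hz, ν, hν, R, ?_⟩
    by_contra hcon
    push Not at hcon
    choose Kf hK using hcon
    obtain ⟨N, μ, hp, hl, hn, hs, n, hres⟩ := hR Kf
    exact hres (hK n N μ hp hl hn hs)
  · rintro ⟨f, hf, hd, hz, ν, hν, R, n, hK⟩ h
    obtain ⟨κ, hκ⟩ := h f hf hd hz ν hν R
    obtain ⟨N, μ, hp, hl, hn, hs, hres⟩ := hK (κ n)
    exact hres (hκ N μ hp hl hn hs n)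

/-- In a kill, the unresolved laws live at levels ABOVE the cutoff: a level-`N` law with `N ≤ K` is
`K`-resolved at every tolerance (the truncation `P_K ⊇ P_N` is exact on it). [folklore] -/
theorem isResolved_const_of_level_le {K N : ℕ} (hNK : N ≤ K) {μ : Measure H3} (hlev : ∀ᵐ u ∂μ, IsLevel N u)
    (n : ℕ) : IsResolved (fun _ => K) μ n := by
  have hlevK : ∀ᵐ u ∂μ, IsLevel K u := hlev.mono fun u hu k hk => hu k fun h =>
    hk (Finset.mem_erase.2 ⟨(Finset.mem_erase.1 h).1, Torus.freqBall_mono hNK (Finset.mem_erase.1 h).2⟩)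
  unfold IsResolved
  rw [lintegral_congr_ae (hlevK.mono fun u hu => (eGradNormSq_fourierTruncate_of_isLevel hu).symm)]
  exact le_self_add

end KillShape


/-! ## §6 The known `N`-uniform input: the energy row bounds the quantity to be resolved

For every law admitted by the crux, `ν ∫‖∇u‖² dμ = ∫ (u,f) dμ ≤ ‖f‖₂ R` (the energy row of
`CubicParityLoud/Negative/EnergyRow` — the admissible quadratic test `Σ_a (u,e_a)²` over the Galerkin frame —
plus Cauchy–Schwarz): the mean enstrophy `∫⁻ ‖∇u‖² dμ ≤ ‖f‖₂R/ν` is bounded UNIFORMLY in `N` and `μ`; the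
crux is only about its spectral DISTRIBUTION. (The second known input, Foias–Guillopé–Temam
`⟨|Au|^{2/3}⟩ ≤ c`, FMRT IV (3.6), is a time-average estimate not available row-by-row here.) -/

section Budget

/-- **Energy row for the crux's laws**: level-`N`, bounded support, stationary at all orders ⇒
`ensembleDissipation ν μ = ∫ (u, f) dμ` (`f ∈ L²`). [folklore] -/
theorem ensembleDissipation_eq_of_isStationary {ν : ℝ} {f : T3 → R3} (hf : MemLp f 2 volume) {N : ℕ}
    {μ : Measure H3} [IsProbabilityMeasure μ] (hlev : ∀ᵐ u ∂μ, IsLevel N u) {R : ℝ}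
    (hR : ∀ᵐ u ∂μ, ‖u‖ ≤ R) (hstat : IsStationary ν f N μ) :
    Torus.ensembleDissipation ν μ = ∫ u, Torus.pairing u.1 f ∂μ := by
  have h1 : Integrable (fun u : H3 => ‖u‖) μ :=
    Integrable.of_bound continuous_norm.aestronglyMeasurable R (hR.mono fun u hu => by simpa using hu)
  obtain ⟨hI, h0⟩ := hstat _ (Theorems.CubicParityLoud.Negative.frameG N)
    (Theorems.CubicParityLoud.Negative.energyPoly _) (Theorems.CubicParityLoud.Negative.isBandTest_frameG N)
  exact Theorems.CubicParityLoud.Negative.ensembleDissipation_eq_of_energyRow hf hlev h1 hI h0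

/-- The mean energy of a law supported in `‖u‖ ≤ R` is at most `R²`. [folklore] -/
theorem ensembleEnergy_le_sq {μ : Measure H3} [IsProbabilityMeasure μ] {R : ℝ} (hR : ∀ᵐ u ∂μ, ‖u‖ ≤ R) :
    Torus.ensembleEnergy μ ≤ R ^ 2 := by
  have h2 : Integrable (fun u : H3 => ‖u‖ ^ 2) μ :=
    Integrable.of_bound (continuous_norm.pow 2).aestronglyMeasurable (R ^ 2) (hR.mono fun u hu => by
      rw [Real.norm_eq_abs, abs_of_nonneg (by positivity)]
      exact pow_le_pow_left₀ (norm_nonneg _) hu 2)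
  unfold Torus.ensembleEnergy
  calc ∫ u, ‖u‖ ^ 2 ∂μ ≤ ∫ _u, R ^ 2 ∂μ := integral_mono_ae h2 (integrable_const _)
        (hR.mono fun u hu => pow_le_pow_left₀ (norm_nonneg _) hu 2)
    _ = R ^ 2 := by simp

/-- **Power ceiling for the crux's laws**: `ν ∫‖∇u‖² dμ ≤ ‖f‖₂ R` (`R ≥ 0`), uniformly in the level `N`.
[folklore] -/
theorem ensembleDissipation_le_of_isStationary {ν : ℝ} {f : T3 → R3} (hf : MemLp f 2 volume) {N : ℕ}
    {μ : Measure H3} [IsProbabilityMeasure μ] (hlev : ∀ᵐ u ∂μ, IsLevel N u) {R : ℝ} (hR0 : 0 ≤ R)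
    (hR : ∀ᵐ u ∂μ, ‖u‖ ≤ R) (hstat : IsStationary ν f N μ) :
    Torus.ensembleDissipation ν μ ≤ Real.sqrt (∫ x, ‖f x‖ ^ 2) * R := by
  have h2 : Integrable (fun u : H3 => ‖u‖ ^ 2) μ :=
    Integrable.of_bound (continuous_norm.pow 2).aestronglyMeasurable (R ^ 2) (hR.mono fun u hu => by
      rw [Real.norm_eq_abs, abs_of_nonneg (by positivity)]
      exact pow_le_pow_left₀ (norm_nonneg _) hu 2)
  rw [ensembleDissipation_eq_of_isStationary hf hlev hR hstat]
  refine (Theorems.CubicParityLoud.Negative.integral_pairing_le hf h2).trans ?_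
  gcongr
  calc Real.sqrt (Torus.ensembleEnergy μ) ≤ Real.sqrt (R ^ 2) := Real.sqrt_le_sqrt (ensembleEnergy_le_sq hR)
    _ = R := Real.sqrt_sq hR0

/-- The mean enstrophy of a level-`N` law with bounded support is finite. [folklore] -/
theorem ensembleEnstrophy_ne_top {N : ℕ} {μ : Measure H3} [IsProbabilityMeasure μ] (hlev : ∀ᵐ u ∂μ, IsLevel N u)
    {R : ℝ} (hR : ∀ᵐ u ∂μ, ‖u‖ ≤ R) : Torus.ensembleEnstrophy μ ≠ ⊤ := by
  have h1 := ensembleEnstrophy_le_of_level hlev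
  have h2 : ∫⁻ u : H3, ‖u‖ₑ ^ 2 ∂μ ≤ ∫⁻ _u : H3, ENNReal.ofReal (R ^ 2) ∂μ :=
    lintegral_mono_ae (hR.mono fun u hu => by
      rw [← ofReal_norm, ← ENNReal.ofReal_pow (norm_nonneg _)]
      exact ENNReal.ofReal_le_ofReal (pow_le_pow_left₀ (norm_nonneg _) hu 2))
  rw [lintegral_const, measure_univ, mul_one] at h2
  exact ne_top_of_le_ne_top (ENNReal.mul_ne_top ENNReal.ofReal_ne_top (ne_top_of_le_ne_top ENNReal.ofReal_ne_top h2)) h1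

/-- **The quantity to be resolved is `N`-uniformly bounded**: `∫⁻ ‖∇u‖² dμ ≤ ‖f‖₂ R / ν` for every law
admitted by the crux at `(f, ν, R)`, whatever the level. Only the spectral distribution of this bounded
budget is at stake in `ResolvedDissipation`. [folklore] -/
theorem ensembleEnstrophy_le_of_isStationary {ν : ℝ} (hν : 0 < ν) {f : T3 → R3} (hf : MemLp f 2 volume)
    {N : ℕ} {μ : Measure H3} [IsProbabilityMeasure μ] (hlev : ∀ᵐ u ∂μ, IsLevel N u) {R : ℝ} (hR0 : 0 ≤ R)
    (hR : ∀ᵐ u ∂μ, ‖u‖ ≤ R) (hstat : IsStationary ν f N μ) :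
    Torus.ensembleEnstrophy μ ≤ ENNReal.ofReal (Real.sqrt (∫ x, ‖f x‖ ^ 2) * R / ν) := by
  have h := ensembleDissipation_le_of_isStationary hf hlev hR0 hR hstat
  unfold Torus.ensembleDissipation at h
  rw [← ENNReal.ofReal_toReal (ensembleEnstrophy_ne_top hlev hR)]
  refine ENNReal.ofReal_le_ofReal ?_
  rw [le_div_iff₀ hν, mul_comm]
  exact h

end Budget


/-! ## §7 Schedule calculus (information for provers): resolution is monotone in the cutoff and the tolerance

So a schedule may always be replaced by a larger one (e.g. its running maximum, or `max κ N₀`): WLOG `κ` is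
monotone and exceeds any given level. -/

section Schedule

/-- Truncated enstrophy is monotone in the cutoff: `‖∇P_K v‖² ≤ ‖∇P_{K'} v‖²` for `K ≤ K'` (integrable `v`).
[folklore] -/
theorem eGradNormSq_fourierTruncate_mono {K K' : ℕ} (hKK' : K ≤ K') {v : T3 → R3} (hv : Integrable v volume) :
    Torus.eGradNormSq (Torus.fourierTruncate K v) ≤ Torus.eGradNormSq (Torus.fourierTruncate K' v) := by
  rw [Torus.eGradNormSq_eq_tsum, Torus.eGradNormSq_eq_tsum]
  gcongr with k
  rw [Torus.mFourierCoeff_fourierTruncate hv K k, Torus.mFourierCoeff_fourierTruncate hv K' k]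
  by_cases hk : k ∈ Torus.freqBall K
  · rw [if_pos hk, if_pos (Torus.freqBall_mono hKK' hk)]
  · rw [if_neg hk]
    simp

/-- **Resolution is monotone in the schedule**: a larger cutoff at step `n` still resolves. [folklore] -/
theorem IsResolved.mono {κ κ' : ℕ → ℕ} {μ : Measure H3} {n : ℕ} (h : IsResolved κ μ n) (hκ : κ n ≤ κ' n) :
    IsResolved κ' μ n := by
  unfold IsResolved at h ⊢
  refine h.trans ?_
  gcongr with u
  exact eGradNormSq_fourierTruncate_mono hκ ((Lp.memLp (u.1 : L2T3)).integrable one_le_two)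

/-- **Resolution is monotone in the tolerance**: the cutoff `κ n` also serves every coarser tolerance
`1/(m+1) ≥ 1/(n+1)`. [folklore] -/
theorem IsResolved.of_le {κ : ℕ → ℕ} {μ : Measure H3} {m n : ℕ} (h : IsResolved κ μ n) (hmn : m ≤ n) :
    IsResolved (fun _ => κ n) μ m := by
  unfold IsResolved at h ⊢
  refine h.trans ?_
  gcongr

end Schedule


end Summit.AnomalousDissipation.AnomalousDissipation.Theorems.ResolvedDissipation.Negative
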